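import Summits.QuantumFields.YangMills.Theorems.ColdStartUniversalityLatticeLangevinDynkinCell
import Summits.QuantumFields.YangMills.Theorems.ColdStartUniversalityLatticeLangevinDynkinPartition
import HarnessLib

/-!
# Route `ColdStartUniversality`, rung `stub_fixedCutoffMixing` of K_A1 (stmt-QuantumFields-24809):
# Dynkin's formula in expectation for vector Itô processes driven by a Brownian vector

Helper file (seat `ym-line-csu-p1`, g6) for the `WilsonMeasureLangevinInvariant` wall of the rung
(`Cruxes/UniformColdStartMixing/Lines/rung_fixedCutoffMixing.md`, step 2 "polynomial Dynkin"): the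
**Itô / Dynkin formula in (conditional) expectation** for a vector Itô process

  `X_t^i = X_0^i + ∫₀ᵗ bⁱ_r dr + ∑_k ∫₀ᵗ σ^{ik}_r dW^k_r`   (`i ∈ ι`)

with bounded progressive coefficients, driven by the coordinates of a Brownian vector `W` and
adapted to its JOINT raw natural filtration `𝓕` — the shape of every solution of the lattice
Langevin SDE `LinkSDE.IsSolution` (matrix entries as components, flat noise as driver).  For
`f` with second-order Taylor data `g = ∇f`, `h = ∇²f` (bounded, Lipschitz, third-order remainder),
`s ≤ t` and every bounded `𝓕_s`-measurable `Z`: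

  `E[Z (f(X_t) - f(X_s))] = E[Z ∫_{(s,t]} (Lf)_r dr]`,
  `(Lf)_r = ∑_i g_i(X_r) bⁱ_r + ½ ∑_{ij} h_{ij}(X_r) ∑_k σ^{ik}_r σ^{jk}_r`

(`dynkin_expectation`), i.e. `f(X_t) - f(X_0) - ∫₀ᵗ (Lf)_r dr` has orthogonal increments (is a
martingale in the weak sense).  Proof: the one-cell estimate `cell_estimate` (second-order Taylor
expansion; martingale terms by the covariation theorem `IsItoIntegral.integral_mul_sub_mul_sub`;
remainder by fourth moments) summed over uniform partitions (`eq_of_cell_estimate`).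
No definition, no sorry, standard axioms.  RECORD-rung plumbing (R3); the Yang–Mills mass gap is
NOT proved.
-/

set_option autoImplicit false

noncomputable section

namespace Summit.QuantumFields.YangMills.Theorems.ColdStartUniversality

open MeasureTheory ProbabilityTheory Filter Finset
open scoped NNReal ENNReal Topology
open Literature.Probability.Process

section Vec

variable {Ω : Type*} {mΩ : MeasurableSpace Ω} {P : Measure Ω} [IsProbabilityMeasure P] {d : ℕ}
  {W : ℝ≥0 → Ω → (Fin d → ℝ)} {ι : Type} [Fintype ι]
  {X : ℝ≥0 → Ω → (ι → ℝ)} {b : ι → ℝ≥0 → Ω → ℝ} {σ J : ι → Fin d → ℝ≥0 → Ω → ℝ} {M : ℝ}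
  {f : (ι → ℝ) → ℝ} {g : ι → (ι → ℝ) → ℝ} {h : ι → ι → (ι → ℝ) → ℝ} {Cf : ℝ}
  {s t : ℝ≥0} {Z : Ω → ℝ} {C : ℝ}

/-- **Dynkin's formula in (conditional) expectation for a vector Itô process driven by a Brownian
vector (joint filtration).**  See the module docstring. [folklore] -/
theorem dynkin_expectation (hW : IsBrownianVec W P)
    (hb : ∀ i, IsStronglyProgressive hW.natFiltration (b i))
    (hσ : ∀ i k, IsStronglyProgressive hW.natFiltration (σ i k))
    (hbM : ∀ i r ω, |b i r ω| ≤ M) (hσM : ∀ i k r ω, |σ i k r ω| ≤ M)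
    (hJ : ∀ i k, IsItoIntegral (σ i k) (fun r ω => W r ω k) (J i k) hW.natFiltration P)
    (hXm : ∀ i, Measurable fun p : Ω × ℝ ↦ X p.2.toNNReal p.1 i)
    (hXa : ∀ i t, StronglyMeasurable[hW.natFiltration t] (fun ω ↦ X t ω i))
    (hXeq : ∀ i, ∀ᵐ ω ∂P, ∀ t, X t ω i = X 0 ω i + (∫ r in (0 : ℝ)..t, b i r.toNNReal ω) + ∑ k, J i k t ω)
    (hfc : Continuous f) (hgc : ∀ i, Continuous (g i)) (hhc : ∀ i j, Continuous (h i j))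
    (hfB : ∀ y, |f y| ≤ Cf) (hgB : ∀ i y, |g i y| ≤ Cf) (hhB : ∀ i j y, |h i j y| ≤ Cf)
    (hgL : ∀ i y y', |g i y - g i y'| ≤ Cf * ∑ l, |y l - y' l|)
    (hhL : ∀ i j y y', |h i j y - h i j y'| ≤ Cf * ∑ l, |y l - y' l|)
    (hT : ∀ y Δ : ι → ℝ, |f (y + Δ) - f y - ∑ i, g i y * Δ i - (1 / 2) * ∑ i, ∑ j, h i j y * (Δ i * Δ j)|
      ≤ Cf * ∑ i, |Δ i| ^ 3)
    (hst : s ≤ t) (hZ : StronglyMeasurable[hW.natFiltration s] Z) (hC : ∀ ω, |Z ω| ≤ C) :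
    ∫ ω, Z ω * (f (X t ω) - f (X s ω)) ∂P =
      ∫ ω, Z ω * (∫ r in Set.Ioc (s : ℝ) t, (∑ i, g i (X r.toNNReal ω) * b i r.toNNReal ω +
        (1 / 2) * ∑ i, ∑ j, h i j (X r.toNNReal ω) * ∑ k, σ i k r.toNNReal ω * σ j k r.toNNReal ω)) ∂P := by
  classical
  obtain ⟨ω₀, -⟩ := nonempty_of_measure_ne_zero (μ := P) (s := Set.univ)
    (by rw [measure_univ]; exact one_ne_zero)
  have hC0 : 0 ≤ C := (abs_nonneg _).trans (hC ω₀)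
  have hCf0 : 0 ≤ Cf := (abs_nonneg _).trans (hfB (X s ω₀))
  have hMi : ∀ i : ι, 0 ≤ M := fun i ↦ (abs_nonneg _).trans (hbM i 0 ω₀)
  -- measurability
  have hbm : ∀ i, Measurable fun p : Ω × ℝ ↦ b i p.2.toNNReal p.1 := fun i ↦
    measurable_toNNReal_of_isStronglyProgressive (hb i)
  have hσm : ∀ i k, Measurable fun p : Ω × ℝ ↦ σ i k p.2.toNNReal p.1 := fun i k ↦
    measurable_toNNReal_of_isStronglyProgressive (hσ i k)
  have hXvec : Measurable fun p : Ω × ℝ ↦ X p.2.toNNReal p.1 := measurable_pi_lambda _ hXm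
  have hXt : ∀ (r : ℝ≥0), Measurable (X r) := fun r ↦
    measurable_pi_lambda _ fun i ↦ ((hXa i r).mono (hW.natFiltration.le r)).measurable
  have hZm : AEStronglyMeasurable Z P := (hZ.mono (hW.natFiltration.le s)).aestronglyMeasurable
  -- the generator integrand
  set L : ℝ → Ω → ℝ := fun r ω ↦ ∑ i, g i (X r.toNNReal ω) * b i r.toNNReal ω +
    (1 / 2) * ∑ i, ∑ j, h i j (X r.toNNReal ω) * ∑ k, σ i k r.toNNReal ω * σ j k r.toNNReal ω with hL
  have hLm : Measurable fun p : Ω × ℝ ↦ L p.2 p.1 := by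
    refine (Finset.measurable_sum _ fun i _ ↦ ((hgc i).measurable.comp hXvec).mul (hbm i)).add
      ((Finset.measurable_sum _ fun i _ ↦ Finset.measurable_sum _ fun j _ ↦
        ((hhc i j).measurable.comp hXvec).mul (Finset.measurable_sum _ fun k _ ↦
          (hσm i k).mul (hσm j k))).const_mul _)
  set KL : ℝ := (Fintype.card ι) * (Cf * M) +
    (1 / 2) * ((Fintype.card ι) * ((Fintype.card ι) * (Cf * (d * (M * M))))) with hKL
  have hLb : ∀ r ω, |L r ω| ≤ KL := by
    intro r ω
    rw [hL]
    refine (abs_add_le _ _).trans (add_le_add ?_ ?_)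
    · refine (abs_sum_le_sum_abs _ _).trans ((sum_le_sum fun i _ ↦ ?_).trans
        (by rw [sum_const, card_univ, nsmul_eq_mul]))
      rw [abs_mul]; exact mul_le_mul (hgB i _) (hbM i _ _) (abs_nonneg _) hCf0
    · rw [abs_mul, abs_of_pos (by norm_num : (0 : ℝ) < 1 / 2)]
      refine mul_le_mul_of_nonneg_left ?_ (by norm_num)
      refine (abs_sum_le_sum_abs _ _).trans ((sum_le_sum fun i _ ↦ ?_).trans
        (by rw [sum_const, card_univ, nsmul_eq_mul]))
      refine (abs_sum_le_sum_abs _ _).trans ((sum_le_sum fun j _ ↦ ?_).trans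
        (by rw [sum_const, card_univ, nsmul_eq_mul]))
      rw [abs_mul]
      refine mul_le_mul (hhB i j _) ?_ (abs_nonneg _) hCf0
      refine (abs_sum_le_sum_abs _ _).trans ((sum_le_sum fun k _ ↦ ?_).trans
        (by rw [sum_const, card_univ, Fintype.card_fin, nsmul_eq_mul]))
      rw [abs_mul]; exact mul_le_mul (hσM i k _ _) (hσM j k _ _) (abs_nonneg _) (hMi i)
  -- pathwise integrability and additivity of the time integral
  have hLpath : ∀ ω, Measurable fun r : ℝ ↦ L r ω := fun ω ↦ hLm.comp measurable_prodMk_left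
  have hLint : ∀ ω (a c : ℝ≥0), IntegrableOn (fun r : ℝ ↦ L r ω) (Set.Ioc (a : ℝ) c) volume := by
    intro ω a c
    refine ⟨(hLpath ω).aestronglyMeasurable, ?_⟩
    exact HasFiniteIntegral.of_bounded (μ := volume.restrict (Set.Ioc (a : ℝ) c)) (C := KL)
      (ae_of_all _ fun r ↦ by rw [Real.norm_eq_abs]; exact hLb r ω)
  have hLadd : ∀ ω (a c e : ℝ≥0), a ≤ c → c ≤ e →
      (∫ r in Set.Ioc (a : ℝ) c, L r ω) + (∫ r in Set.Ioc (c : ℝ) e, L r ω) =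
        ∫ r in Set.Ioc (a : ℝ) e, L r ω := by
    intro ω a c e hac hce
    rw [← setIntegral_union (Set.Ioc_disjoint_Ioc_of_le le_rfl) measurableSet_Ioc (hLint ω a c)
      (hLint ω c e), Set.Ioc_union_Ioc_eq_Ioc (NNReal.coe_le_coe.2 hac) (NNReal.coe_le_coe.2 hce)]
  -- measurability / integrability in `ω`
  have hΛm : ∀ a c : ℝ≥0, AEStronglyMeasurable (fun ω ↦ ∫ r in Set.Ioc (a : ℝ) c, L r ω) P := fun a c ↦
    (hLm.stronglyMeasurable.integral_prod_right' (ν := volume.restrict (Set.Ioc (a : ℝ) c))).aestronglyMeasurable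
  have hΛb : ∀ (a c : ℝ≥0) ω, a ≤ c → |∫ r in Set.Ioc (a : ℝ) c, L r ω| ≤ KL * ((c : ℝ) - a) := by
    intro a c ω hac
    have hh := norm_setIntegral_le_of_norm_le_const (μ := volume) (s := Set.Ioc (a : ℝ) c)
      (f := fun r ↦ L r ω) (C := KL) (by rw [Real.volume_Ioc]; exact ENNReal.ofReal_lt_top)
      (fun r _ ↦ by rw [Real.norm_eq_abs]; exact hLb r ω)
    rw [Real.volume_real_Ioc_of_le (NNReal.coe_le_coe.2 hac), Real.norm_eq_abs] at hh
    exact hh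
  have hbddI : ∀ {φ : Ω → ℝ} {K : ℝ}, AEStronglyMeasurable φ P → (∀ ω, |φ ω| ≤ K) → Integrable φ P :=
    fun {φ K} hφ hK ↦ (integrable_const K).mono' hφ (ae_of_all _ fun ω ↦ by
      rw [Real.norm_eq_abs]; exact hK ω)
  have iΛ : ∀ a c : ℝ≥0, a ≤ c → Integrable (fun ω ↦ Z ω * ∫ r in Set.Ioc (a : ℝ) c, L r ω) P :=
    fun a c hac ↦ hbddI (hZm.mul (hΛm a c)) (K := C * (KL * ((c : ℝ) - a))) fun ω ↦ by
      rw [abs_mul]; exact mul_le_mul (hC ω) (hΛb a c ω hac) (abs_nonneg _) hC0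
  have iΦ : ∀ r : ℝ≥0, Integrable (fun ω ↦ Z ω * f (X r ω)) P := fun r ↦
    hbddI (hZm.mul (hfc.measurable.comp (hXt r)).aestronglyMeasurable) (K := C * Cf) fun ω ↦ by
      rw [abs_mul]; exact mul_le_mul (hC ω) (hfB _) (abs_nonneg _) hC0
  -- the abstract partition lemma
  set Kc : ℝ := ((Fintype.card ι : ℝ) ^ 2 * C * M * Cf * Real.sqrt (2 * M ^ 2 + 2 * (d : ℝ) ^ 2 * M ^ 2) +
      (1 / 2) * (Fintype.card ι : ℝ) ^ 3 * d * C * (M * M) * Cf *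
        Real.sqrt (2 * M ^ 2 + 2 * (d : ℝ) ^ 2 * M ^ 2) +
      (1 / 2) * (Fintype.card ι : ℝ) ^ 2 * (C * Cf) * (M ^ 2 * (1 + 2 * d)) +
      C * Cf * (Fintype.card ι) * (Real.sqrt (2 * M ^ 2 + 2 * (d : ℝ) ^ 2 * M ^ 2) *
        Real.sqrt (8 * M ^ 4 + 72 * (d : ℝ) ^ 4 * M ^ 4))) with hKc
  have key := eq_of_cell_estimate (Φ := fun r ↦ ∫ ω, Z ω * f (X r ω) ∂P)
    (Λ := fun a c ↦ ∫ ω, Z ω * (∫ r in Set.Ioc (a : ℝ) c, L r ω) ∂P) (K := Kc) ?_ ?_ hst ?_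
  · -- conclude
    have e : ∫ ω, Z ω * (f (X t ω) - f (X s ω)) ∂P =
        (∫ ω, Z ω * f (X t ω) ∂P) - ∫ ω, Z ω * f (X s ω) ∂P := by
      rw [← integral_sub (iΦ t) (iΦ s)]
      exact integral_congr_ae (ae_of_all _ fun ω ↦ by ring)
    rw [e, key]
  · -- additivity
    intro a c e hac hce
    rw [← integral_add (iΛ a c hac) (iΛ c e hce)]
    refine integral_congr_ae (ae_of_all _ fun ω ↦ ?_)
    dsimp only
    rw [← mul_add, hLadd ω a c e hac hce]
  · -- `Λ a a = 0`
    intro a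
    simp
  · -- the cell estimate
    intro a c hsa hac hct hδ1
    have hZa : StronglyMeasurable[hW.natFiltration a] Z := hZ.mono (hW.natFiltration.mono hsa)
    have hcell := cell_estimate hW hb hσ hbM hσM hJ hXm hXa hXeq hfc hgc hhc hfB hgB hhB hgL hhL hT
      hac hδ1 hZa hC
    have e : (∫ ω, Z ω * f (X c ω) ∂P) - (∫ ω, Z ω * f (X a ω) ∂P) -
        ∫ ω, Z ω * (∫ r in Set.Ioc (a : ℝ) c, L r ω) ∂P =
        ∫ ω, Z ω * (f (X c ω) - f (X a ω)) ∂P - ∫ ω, Z ω * (∫ r in Set.Ioc (a : ℝ) c, L r ω) ∂P := by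
      rw [← integral_sub (iΦ c) (iΦ a)]
      congr 1
      exact integral_congr_ae (ae_of_all _ fun ω ↦ by ring)
    rw [e]
    refine hcell.trans (le_of_eq ?_)
    have hδ0 : 0 ≤ (c : ℝ) - a := sub_nonneg.2 (NNReal.coe_le_coe.2 hac)
    have hconv : ((c : ℝ) - a) * Real.sqrt ((c : ℝ) - a) = ((c : ℝ) - a) ^ (3 / 2 : ℝ) := by
      rw [Real.sqrt_eq_rpow, show (3 / 2 : ℝ) = 1 + 1 / 2 by norm_num,
        Real.rpow_add' hδ0 (by norm_num), Real.rpow_one]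
    rw [hconv]

end Vec

end Summit.QuantumFields.YangMills.Theorems.ColdStartUniversality

end
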